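import Mathlib
import Summits.AnomalousDissipation.AnomalousDissipation.Theorems.MarginalStabilityChainStretchedVortexRowsStubRowVorticityConstructionToolsFar

/-!
# Stub `stub_rowVorticityConstruction` (crux stmt-AnomalousDissipation-3009) — tools V(b):
# the shear far field of the cylinder Biot–Savart velocity, II — `u → ∓M/(2L)`

Helper file (supports stmt-AnomalousDissipation-3009), continuation of tools V(a) (`…ToolsFar`). For `L > 0`, a
continuous `L`-periodic plane field `ω` with `|ω(x,y)| ≤ C e^{−a y²}` and
`u(x,y) = −(2L)⁻¹ ∫_{S_L} K₁(q) ω(x − q₁, y − q₂) dq`: the `tanh` term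
`∫ tanh(2πq₂/L) ω(x − q₁, y − q₂) dq = ∫ tanh(2π(y − q₂)/L) ω(x − q₁, q₂) dq → ±∫_{S_L} ω(x − q₁, q₂) dq`
(`setIntegral_strip_reflect_snd`, `tendsto_tanhConv_atTop/atBot`), the shifted cell integral equals the cell
circulation `M = ∫_{S_L} ω` (`setIntegral_strip_comp_sub_of_periodic`), and so
`∫ K₁ ω(x − q₁, y − q₂) dq → ±M` (`tendsto_rowConvU_atTop/atBot`), i.e. `u → ∓M/(2L)`; together with `v → 0`
from V(a) this is the registered sub-goal `stub_rowVorticityConstruction_biotSavartFarField` (the SHEAR FAR FIELD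
clause of the stub: `M = −L` gives `u → ±1/2`). All `[folklore]`.
-/

set_option linter.dupNamespace false

noncomputable section

open Real Set Filter Topology MeasureTheory

namespace Summit.AnomalousDissipation.AnomalousDissipation.Theorems.MarginalStabilityChainStretchedVortexRows.RowBiotSavart

section Limits

variable {L : ℝ} {ω : ℝ → ℝ → ℝ} {C a : ℝ}

/-! ### The main term `∫ tanh(2πq₂/L) ω(x − q₁, y − q₂) dq` -/

/-- A continuous Gaussian-bounded field, shifted, is integrable on the strip. [folklore] -/
theorem integrable_strip_field (L : ℝ) (hω : Continuous fun p : ℝ × ℝ => ω p.1 p.2)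
    (hb : ∀ x y, |ω x y| ≤ C * Real.exp (-a * y ^ 2)) (ha : 0 < a) (x : ℝ) :
    Integrable (fun q : ℝ × ℝ => ω (x - q.1) q.2)
      ((volume : Measure (ℝ × ℝ)).restrict (Ioc (-(L / 2)) (L / 2) ×ˢ (univ : Set ℝ))) := by
  have h1 : Integrable (fun q : ℝ × ℝ => C * Real.exp (-a * q.2 ^ 2))
      ((volume : Measure (ℝ × ℝ)).restrict (Ioc (-(L / 2)) (L / 2) ×ˢ (univ : Set ℝ))) :=
    integrable_strip_of_snd L ((integrable_exp_neg_mul_sq ha).const_mul C)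
  have hc : Continuous fun q : ℝ × ℝ => ω (x - q.1) q.2 :=
    hω.comp ((continuous_const.sub continuous_fst).prodMk continuous_snd)
  refine h1.mono' hc.aestronglyMeasurable (Eventually.of_forall fun q => ?_)
  rw [Real.norm_eq_abs]; exact hb _ _

/-- **Reflection–translation in `q₂`**: `∫_{S_L} p(q₂) ω(x − q₁, y − q₂) dq = ∫_{S_L} p(y − q₂) ω(x − q₁, q₂) dq`
for any measurable profile `p` (Lebesgue measure on the line is invariant under `t ↦ y − t`). [folklore] -/
theorem setIntegral_strip_reflect_snd (L : ℝ) (p : ℝ → ℝ) (ω : ℝ → ℝ → ℝ) (x y : ℝ) :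
    ∫ q in Ioc (-(L / 2)) (L / 2) ×ˢ (univ : Set ℝ), p q.2 * ω (x - q.1) (y - q.2) =
      ∫ q in Ioc (-(L / 2)) (L / 2) ×ˢ (univ : Set ℝ), p (y - q.2) * ω (x - q.1) q.2 := by
  rw [volume_restrict_strip]
  set e : ℝ × ℝ ≃ᵐ ℝ × ℝ := (MeasurableEquiv.refl ℝ).prodCongr (MeasurableEquiv.subLeft y)
  have he : MeasurePreserving e (((volume : Measure ℝ).restrict (Ioc (-(L / 2)) (L / 2))).prod volume)
      (((volume : Measure ℝ).restrict (Ioc (-(L / 2)) (L / 2))).prod volume) :=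
    (MeasurePreserving.id _).prod (Measure.measurePreserving_sub_left volume y)
  have h := he.integral_comp' (fun q : ℝ × ℝ => p (y - q.2) * ω (x - q.1) q.2)
  refine Eq.trans (integral_congr_ae (Eventually.of_forall fun q => ?_)) h
  change p q.2 * ω (x - q.1) (y - q.2) = p (y - (y - q.2)) * ω (x - q.1) (y - q.2)
  rw [sub_sub_cancel]

/-- **The `tanh` term converges to the shifted cell integral**:
`∫_{S_L} tanh(2πq₂/L) ω(x − q₁, y − q₂) dq → ∫_{S_L} ω(x − q₁, q₂) dq` as `y → +∞`. [folklore] -/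
theorem tendsto_tanhConv_atTop (hL : 0 < L) (hω : Continuous fun p : ℝ × ℝ => ω p.1 p.2)
    (hb : ∀ x y, |ω x y| ≤ C * Real.exp (-a * y ^ 2)) (ha : 0 < a) (x : ℝ) :
    Tendsto (fun y => ∫ q in Ioc (-(L / 2)) (L / 2) ×ˢ (univ : Set ℝ),
      Real.sinh (2 * π * q.2 / L) / Real.cosh (2 * π * q.2 / L) * ω (x - q.1) (y - q.2)) atTop
      (𝓝 (∫ q in Ioc (-(L / 2)) (L / 2) ×ˢ (univ : Set ℝ), ω (x - q.1) q.2)) := by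
  simp_rw [setIntegral_strip_reflect_snd L (fun t => Real.sinh (2 * π * t / L) / Real.cosh (2 * π * t / L)) ω x]
  have hi := integrable_strip_field L hω hb ha x
  rw [show (∫ q in Ioc (-(L / 2)) (L / 2) ×ˢ (univ : Set ℝ), ω (x - q.1) q.2) =
    ∫ q in Ioc (-(L / 2)) (L / 2) ×ˢ (univ : Set ℝ), 1 * ω (x - q.1) q.2 by simp]
  refine tendsto_integral_filter_of_dominated_convergence (fun q => ‖ω (x - q.1) q.2‖) ?_ ?_ hi.norm ?_
  · refine Eventually.of_forall fun y => ?_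
    have : Continuous fun q : ℝ × ℝ =>
        Real.sinh (2 * π * (y - q.2) / L) / Real.cosh (2 * π * (y - q.2) / L) * ω (x - q.1) q.2 := by
      refine Continuous.mul ?_ (hω.comp ((continuous_const.sub continuous_fst).prodMk continuous_snd))
      exact Continuous.div (by fun_prop) (by fun_prop) fun q => (Real.cosh_pos _).ne'
    exact this.aestronglyMeasurable
  · refine Eventually.of_forall fun y => Eventually.of_forall fun q => ?_
    rw [norm_mul]
    refine mul_le_of_le_one_left (norm_nonneg _) ?_
    rw [Real.norm_eq_abs, abs_div, abs_of_pos (Real.cosh_pos _), div_le_one (Real.cosh_pos _), Real.abs_sinh,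
      ← Real.cosh_abs]
    exact (Real.sinh_lt_cosh _).le
  · refine Eventually.of_forall fun q => Tendsto.mul_const _ ?_
    have h1 : Tendsto (fun y : ℝ => 2 * π * (y - q.2) / L) atTop atTop := by
      have h0 : Tendsto (fun y : ℝ => y - q.2) atTop atTop :=
        tendsto_atTop_atTop.2 fun b => ⟨b + q.2, fun y hy => by linarith⟩
      refine (h0.const_mul_atTop (by positivity : (0:ℝ) < 2 * π / L)).congr fun y => ?_
      ring
    exact tendsto_sinh_div_cosh_atTop.comp h1

/-- The same `tanh` term converges to MINUS the shifted cell integral as `y → −∞`. [folklore] -/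
theorem tendsto_tanhConv_atBot (hL : 0 < L) (hω : Continuous fun p : ℝ × ℝ => ω p.1 p.2)
    (hb : ∀ x y, |ω x y| ≤ C * Real.exp (-a * y ^ 2)) (ha : 0 < a) (x : ℝ) :
    Tendsto (fun y => ∫ q in Ioc (-(L / 2)) (L / 2) ×ˢ (univ : Set ℝ),
      Real.sinh (2 * π * q.2 / L) / Real.cosh (2 * π * q.2 / L) * ω (x - q.1) (y - q.2)) atBot
      (𝓝 (-∫ q in Ioc (-(L / 2)) (L / 2) ×ˢ (univ : Set ℝ), ω (x - q.1) q.2)) := by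
  simp_rw [setIntegral_strip_reflect_snd L (fun t => Real.sinh (2 * π * t / L) / Real.cosh (2 * π * t / L)) ω x]
  have hi := integrable_strip_field L hω hb ha x
  rw [← integral_neg, show (∫ q in Ioc (-(L / 2)) (L / 2) ×ˢ (univ : Set ℝ), -ω (x - q.1) q.2) =
    ∫ q in Ioc (-(L / 2)) (L / 2) ×ˢ (univ : Set ℝ), (-1) * ω (x - q.1) q.2 by simp]
  refine tendsto_integral_filter_of_dominated_convergence (fun q => ‖ω (x - q.1) q.2‖) ?_ ?_ hi.norm ?_
  · refine Eventually.of_forall fun y => ?_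
    have : Continuous fun q : ℝ × ℝ =>
        Real.sinh (2 * π * (y - q.2) / L) / Real.cosh (2 * π * (y - q.2) / L) * ω (x - q.1) q.2 := by
      refine Continuous.mul ?_ (hω.comp ((continuous_const.sub continuous_fst).prodMk continuous_snd))
      exact Continuous.div (by fun_prop) (by fun_prop) fun q => (Real.cosh_pos _).ne'
    exact this.aestronglyMeasurable
  · refine Eventually.of_forall fun y => Eventually.of_forall fun q => ?_
    rw [norm_mul]
    refine mul_le_of_le_one_left (norm_nonneg _) ?_
    rw [Real.norm_eq_abs, abs_div, abs_of_pos (Real.cosh_pos _), div_le_one (Real.cosh_pos _), Real.abs_sinh,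
      ← Real.cosh_abs]
    exact (Real.sinh_lt_cosh _).le
  · refine Eventually.of_forall fun q => Tendsto.mul_const _ ?_
    have h1 : Tendsto (fun y : ℝ => 2 * π * (y - q.2) / L) atBot atBot := by
      have h0 : Tendsto (fun y : ℝ => y - q.2) atBot atBot :=
        tendsto_atBot_atBot.2 fun b => ⟨b + q.2, fun y hy => by linarith⟩
      refine (h0.const_mul_atBot (by positivity : (0:ℝ) < 2 * π / L)).congr fun y => ?_
      ring
    exact tendsto_sinh_div_cosh_atBot.comp h1

/-! ### The cell integral does not depend on the shift -/

/-- The integral of an `L`-periodic function over a period is invariant under `s ↦ x − s`. [folklore] -/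
theorem setIntegral_Ioc_comp_sub_of_periodic {G : ℝ → ℝ} (hG : Function.Periodic G L) (hL : 0 < L) (x : ℝ) :
    ∫ s in Ioc (-(L / 2)) (L / 2), G (x - s) = ∫ s in Ioc (-(L / 2)) (L / 2), G s := by
  have hle : -(L / 2) ≤ L / 2 := by linarith
  rw [← intervalIntegral.integral_of_le hle, ← intervalIntegral.integral_of_le hle,
    intervalIntegral.integral_comp_sub_left (fun s => G s) x, show x - L / 2 = x + -(L / 2) by ring,
    show x - -(L / 2) = x + -(L / 2) + L by ring, hG.intervalIntegral_add_eq (x + -(L / 2)) (-(L / 2)),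
    show -(L / 2) + L = L / 2 by ring]

/-- **The shifted cell integral is the cell circulation**: for continuous, `L`-periodic, Gaussian-bounded `ω`,
`∫_{S_L} ω(x − q₁, q₂) dq = ∫_{S_L} ω(q₁, q₂) dq` for every `x`. [folklore] -/
theorem setIntegral_strip_comp_sub_of_periodic (hL : 0 < L) (hω : Continuous fun p : ℝ × ℝ => ω p.1 p.2)
    (hb : ∀ x y, |ω x y| ≤ C * Real.exp (-a * y ^ 2)) (ha : 0 < a) (hper : ∀ x y, ω (x + L) y = ω x y)
    (x : ℝ) :
    ∫ q in Ioc (-(L / 2)) (L / 2) ×ˢ (univ : Set ℝ), ω (x - q.1) q.2 =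
      ∫ q in Ioc (-(L / 2)) (L / 2) ×ˢ (univ : Set ℝ), ω q.1 q.2 := by
  have hi := integrable_strip_field L hω hb ha x
  have hi0 : Integrable (fun q : ℝ × ℝ => ω q.1 q.2)
      ((volume : Measure (ℝ × ℝ)).restrict (Ioc (-(L / 2)) (L / 2) ×ˢ (univ : Set ℝ))) := by
    have := integrable_strip_field L hω hb ha 0
    -- `ω(0 − q₁, q₂)` vs `ω(q₁, q₂)`: use the reflection invariance of the strip in `q₁`? Simpler: shift by
    -- periodicity is not needed — integrability of `ω(q₁,q₂)` follows from the same Gaussian domination.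
    have h1 : Integrable (fun q : ℝ × ℝ => C * Real.exp (-a * q.2 ^ 2))
        ((volume : Measure (ℝ × ℝ)).restrict (Ioc (-(L / 2)) (L / 2) ×ˢ (univ : Set ℝ))) :=
      integrable_strip_of_snd L ((integrable_exp_neg_mul_sq ha).const_mul C)
    exact h1.mono' hω.aestronglyMeasurable (Eventually.of_forall fun q => by rw [Real.norm_eq_abs]; exact hb _ _)
  rw [volume_restrict_strip] at hi hi0 ⊢
  rw [integral_prod _ hi, integral_prod _ hi0]
  have hG : Function.Periodic (fun s => ∫ t, ω s t) L := fun s => by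
    simp only; exact integral_congr_ae (Eventually.of_forall fun t => hper s t)
  exact setIntegral_Ioc_comp_sub_of_periodic hG hL x

/-! ### The far field of `u` -/

/-- The split `∫ K₁ ω(x−q₁,y−q₂) = ∫ R ω(x−q₁,y−q₂) + ∫ tanh ω(x−q₁,y−q₂)` (both pieces integrable). [folklore] -/
theorem rowConvU_split (hL : 0 < L) (hω : Continuous fun p : ℝ × ℝ => ω p.1 p.2)
    (hb : ∀ x y, |ω x y| ≤ C * Real.exp (-a * y ^ 2)) (ha : 0 < a) (x y : ℝ) :
    (∫ q in Ioc (-(L / 2)) (L / 2) ×ˢ (univ : Set ℝ),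
      Real.sinh (2 * π * q.2 / L) / (Real.cosh (2 * π * q.2 / L) - Real.cos (2 * π * q.1 / L)) *
        ω (x - q.1) (y - q.2)) =
      (∫ q in Ioc (-(L / 2)) (L / 2) ×ˢ (univ : Set ℝ),
        (Real.sinh (2 * π * q.2 / L) / (Real.cosh (2 * π * q.2 / L) - Real.cos (2 * π * q.1 / L)) -
          Real.sinh (2 * π * q.2 / L) / Real.cosh (2 * π * q.2 / L)) * ω (x - q.1) (y - q.2)) +
      ∫ q in Ioc (-(L / 2)) (L / 2) ×ˢ (univ : Set ℝ),
        Real.sinh (2 * π * q.2 / L) / Real.cosh (2 * π * q.2 / L) * ω (x - q.1) (y - q.2) := by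
  have hC : 0 ≤ C := by
    have := hb 0 0; simp at this; exact (abs_nonneg _).trans this
  have hωb : ∀ x y, |ω x y| ≤ C := fun x y => (hb x y).trans (by
    have : Real.exp (-a * y ^ 2) ≤ 1 := by rw [Real.exp_le_one_iff]; nlinarith [sq_nonneg y]
    nlinarith)
  have hR := integrable_rowKerU_sub_tanh hL
  have hc : Continuous fun q : ℝ × ℝ => ω (x - q.1) (y - q.2) :=
    hω.comp ((continuous_const.sub continuous_fst).prodMk (continuous_const.sub continuous_snd))
  have i1 : Integrable (fun q : ℝ × ℝ =>
      (Real.sinh (2 * π * q.2 / L) / (Real.cosh (2 * π * q.2 / L) - Real.cos (2 * π * q.1 / L)) -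
        Real.sinh (2 * π * q.2 / L) / Real.cosh (2 * π * q.2 / L)) * ω (x - q.1) (y - q.2))
      ((volume : Measure (ℝ × ℝ)).restrict (Ioc (-(L / 2)) (L / 2) ×ˢ (univ : Set ℝ))) := by
    refine (hR.norm.mul_const C).mono' (hR.aestronglyMeasurable.mul hc.aestronglyMeasurable)
      (Eventually.of_forall fun q => ?_)
    rw [norm_mul]
    exact mul_le_mul_of_nonneg_left (by rw [Real.norm_eq_abs]; exact hωb _ _) (norm_nonneg _)
  have i2 : Integrable (fun q : ℝ × ℝ =>
      Real.sinh (2 * π * q.2 / L) / Real.cosh (2 * π * q.2 / L) * ω (x - q.1) (y - q.2))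
      ((volume : Measure (ℝ × ℝ)).restrict (Ioc (-(L / 2)) (L / 2) ×ˢ (univ : Set ℝ))) := by
    have := integrable_strip_field L hω hb ha x
    rw [volume_restrict_strip] at this ⊢
    set e : ℝ × ℝ ≃ᵐ ℝ × ℝ := (MeasurableEquiv.refl ℝ).prodCongr (MeasurableEquiv.subLeft y)
    have he : MeasurePreserving e (((volume : Measure ℝ).restrict (Ioc (-(L / 2)) (L / 2))).prod volume)
        (((volume : Measure ℝ).restrict (Ioc (-(L / 2)) (L / 2))).prod volume) :=
      (MeasurePreserving.id _).prod (Measure.measurePreserving_sub_left volume y)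
    have h3 : Integrable (fun q : ℝ × ℝ => ω (x - q.1) (y - q.2))
        (((volume : Measure ℝ).restrict (Ioc (-(L / 2)) (L / 2))).prod volume) :=
      (he.integrable_comp_emb e.measurableEmbedding).2 this
    refine (h3.norm).mono' ?_ (Eventually.of_forall fun q => ?_)
    · have : Continuous fun q : ℝ × ℝ =>
          Real.sinh (2 * π * q.2 / L) / Real.cosh (2 * π * q.2 / L) * ω (x - q.1) (y - q.2) :=
        Continuous.mul (Continuous.div (by fun_prop) (by fun_prop) fun q => (Real.cosh_pos _).ne') hc
      exact this.aestronglyMeasurable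
    · rw [norm_mul]
      refine mul_le_of_le_one_left (norm_nonneg _) ?_
      rw [Real.norm_eq_abs, abs_div, abs_of_pos (Real.cosh_pos _), div_le_one (Real.cosh_pos _),
        Real.abs_sinh, ← Real.cosh_abs]
      exact (Real.sinh_lt_cosh _).le
  rw [← integral_add i1 i2]
  refine integral_congr_ae (Eventually.of_forall fun q => ?_)
  ring

/-- **The `K₁`-integral tends to the cell circulation at `+∞`**:
`∫_{S_L} K₁(q) ω(x − q₁, y − q₂) dq → ∫_{S_L} ω` as `y → +∞`. [folklore] -/
theorem tendsto_rowConvU_atTop (hL : 0 < L) (hω : Continuous fun p : ℝ × ℝ => ω p.1 p.2)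
    (hb : ∀ x y, |ω x y| ≤ C * Real.exp (-a * y ^ 2)) (ha : 0 < a) (hper : ∀ x y, ω (x + L) y = ω x y)
    (x : ℝ) :
    Tendsto (fun y => ∫ q in Ioc (-(L / 2)) (L / 2) ×ˢ (univ : Set ℝ),
      Real.sinh (2 * π * q.2 / L) / (Real.cosh (2 * π * q.2 / L) - Real.cos (2 * π * q.1 / L)) *
        ω (x - q.1) (y - q.2)) atTop
      (𝓝 (∫ q in Ioc (-(L / 2)) (L / 2) ×ˢ (univ : Set ℝ), ω q.1 q.2)) := by
  simp_rw [rowConvU_split hL hω hb ha x]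
  rw [← setIntegral_strip_comp_sub_of_periodic hL hω hb ha hper x, show (∫ q in Ioc (-(L / 2)) (L / 2) ×ˢ
    (univ : Set ℝ), ω (x - q.1) q.2) = 0 + ∫ q in Ioc (-(L / 2)) (L / 2) ×ˢ (univ : Set ℝ), ω (x - q.1) q.2
    by simp]
  exact (tendsto_rowConv_zero_of_integrable (integrable_rowKerU_sub_tanh hL) hω hb ha tendsto_sub_sq_atTop
    x).add (tendsto_tanhConv_atTop hL hω hb ha x)

/-- **The `K₁`-integral tends to MINUS the cell circulation at `−∞`**. [folklore] -/
theorem tendsto_rowConvU_atBot (hL : 0 < L) (hω : Continuous fun p : ℝ × ℝ => ω p.1 p.2)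
    (hb : ∀ x y, |ω x y| ≤ C * Real.exp (-a * y ^ 2)) (ha : 0 < a) (hper : ∀ x y, ω (x + L) y = ω x y)
    (x : ℝ) :
    Tendsto (fun y => ∫ q in Ioc (-(L / 2)) (L / 2) ×ˢ (univ : Set ℝ),
      Real.sinh (2 * π * q.2 / L) / (Real.cosh (2 * π * q.2 / L) - Real.cos (2 * π * q.1 / L)) *
        ω (x - q.1) (y - q.2)) atBot
      (𝓝 (-∫ q in Ioc (-(L / 2)) (L / 2) ×ˢ (univ : Set ℝ), ω q.1 q.2)) := by
  simp_rw [rowConvU_split hL hω hb ha x]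
  rw [← setIntegral_strip_comp_sub_of_periodic hL hω hb ha hper x, show (-∫ q in Ioc (-(L / 2)) (L / 2) ×ˢ
    (univ : Set ℝ), ω (x - q.1) q.2) = 0 + -∫ q in Ioc (-(L / 2)) (L / 2) ×ˢ (univ : Set ℝ), ω (x - q.1) q.2
    by simp]
  exact (tendsto_rowConv_zero_of_integrable (integrable_rowKerU_sub_tanh hL) hω hb ha tendsto_sub_sq_atBot
    x).add (tendsto_tanhConv_atBot hL hω hb ha x)

end Limits

end RowBiotSavart

open RowBiotSavart in
/-- **Shear far field of the cylinder Biot–Savart velocity** (registered on stmt-AnomalousDissipation-3009 as the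
helper stub `stub_rowVorticityConstruction_biotSavartFarField` of `stub_rowVorticityConstruction`): for `L > 0`
and a continuous, `L`-periodic plane field `ω` with `|ω(x, y)| ≤ C e^{−a y²}` (`a > 0`), the velocity
`u(x,y) = −(2L)⁻¹ ∫_{S_L} K₁(q) ω(x − q₁, y − q₂) dq`, `v(x,y) = (2L)⁻¹ ∫_{S_L} K₂(q) ω(x − q₁, y − q₂) dq`
satisfies, for every `x`, `u(x, y) → ∓(2L)⁻¹ M` as `y → ±∞` and `v(x, y) → 0` as `y → ±∞`, where
`M = ∫_{S_L} ω` is the circulation per period (`M = −L` gives the crux's far field `u → ±1/2`). [folklore] -/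
theorem stub_rowVorticityConstruction_biotSavartFarField :
    ∀ (L : ℝ) (ω : ℝ → ℝ → ℝ) (C a : ℝ), 0 < L → 0 < a → Continuous (fun p : ℝ × ℝ => ω p.1 p.2) →
      (∀ x y, |ω x y| ≤ C * Real.exp (-a * y ^ 2)) → (∀ x y, ω (x + L) y = ω x y) →
      ∀ x : ℝ,
        Filter.Tendsto (fun y => -(1 / (2 * L)) * ∫ q in Set.Ioc (-(L / 2)) (L / 2) ×ˢ (Set.univ : Set ℝ),
            Real.sinh (2 * Real.pi * q.2 / L) / (Real.cosh (2 * Real.pi * q.2 / L) - Real.cos (2 * Real.pi * q.1 / L)) *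
              ω (x - q.1) (y - q.2)) Filter.atTop
          (nhds (-(1 / (2 * L)) * ∫ q in Set.Ioc (-(L / 2)) (L / 2) ×ˢ (Set.univ : Set ℝ), ω q.1 q.2)) ∧
        Filter.Tendsto (fun y => -(1 / (2 * L)) * ∫ q in Set.Ioc (-(L / 2)) (L / 2) ×ˢ (Set.univ : Set ℝ),
            Real.sinh (2 * Real.pi * q.2 / L) / (Real.cosh (2 * Real.pi * q.2 / L) - Real.cos (2 * Real.pi * q.1 / L)) *
              ω (x - q.1) (y - q.2)) Filter.atBot
          (nhds (1 / (2 * L) * ∫ q in Set.Ioc (-(L / 2)) (L / 2) ×ˢ (Set.univ : Set ℝ), ω q.1 q.2)) ∧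
        Filter.Tendsto (fun y => 1 / (2 * L) * ∫ q in Set.Ioc (-(L / 2)) (L / 2) ×ˢ (Set.univ : Set ℝ),
            Real.sin (2 * Real.pi * q.1 / L) / (Real.cosh (2 * Real.pi * q.2 / L) - Real.cos (2 * Real.pi * q.1 / L)) *
              ω (x - q.1) (y - q.2)) Filter.atTop (nhds 0) ∧
        Filter.Tendsto (fun y => 1 / (2 * L) * ∫ q in Set.Ioc (-(L / 2)) (L / 2) ×ˢ (Set.univ : Set ℝ),
            Real.sin (2 * Real.pi * q.1 / L) / (Real.cosh (2 * Real.pi * q.2 / L) - Real.cos (2 * Real.pi * q.1 / L)) *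
              ω (x - q.1) (y - q.2)) Filter.atBot (nhds 0) := by
  intro L ω C a hL ha hω hb hper x
  refine ⟨(tendsto_rowConvU_atTop hL hω hb ha hper x).const_mul _, ?_,
    by simpa using (tendsto_rowConvV hL hω hb ha tendsto_sub_sq_atTop x).const_mul (1 / (2 * L)),
    by simpa using (tendsto_rowConvV hL hω hb ha tendsto_sub_sq_atBot x).const_mul (1 / (2 * L))⟩
  have h := (tendsto_rowConvU_atBot hL hω hb ha hper x).const_mul (-(1 / (2 * L)))
  refine h.congr' (Eventually.of_forall fun y => rfl) |>.trans ?_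
  rw [mul_neg, neg_mul, neg_neg]

end Summit.AnomalousDissipation.AnomalousDissipation.Theorems.MarginalStabilityChainStretchedVortexRows

end
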